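import Literature.NumberTheory.Automorphic.Liu2021.LemD1AsPrintedIndexedNonVacuityCharacterDecisionAllRanks
import Literature.NumberTheory.Automorphic.Liu2021.LemD1AsPrintedIndexedNonVacuityCharacterDecision
import HarnessLib

/-!
# [Liu2021, App. D Lemma D.1 (3)] bookkeeping — EVERY rank `N ≥ 3`: LINE-carrier collections COLLAPSE at the places of the conjunction

Reproduction ∕ bookkeeping (Literature, THEOREMS ONLY: no definition, no record, no named fact, no `sorry`; nothing is asserted about
Liu's oscillator representations or about the tree's constructed local Weil carriers).

The rank-`N` edition of ✔ `…NonVacuityCharacterDecision` §5–§6 (there: the END's rank `3`).  By ✔ `…CharacterDecisionAllRanks`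
(general-rank Dieudonné engine ✔ `Automorphic/UnitaryIsotropicCharactersDet`), at a place of the conjunction «`c • w = w` ∧ `Odd N` ∧
`v_w(N) = 1` ∧ (`e(w|v) ≠ 1` ∨ `gcd(N, q_v + 1) = 1`)» two characters of `U(V)(F_v)` with the same central character are EQUAL; by the
rank-general §4 of ✔ `…CharacterDecision` (`apply_scalar_eq_chi_of_item1_of_lineCarrier`, `areIsomorphicRep_of_lineCarriers_of_eq`) a LINE
carrier satisfying [Lem. D.1 (1)] AS PRINTED acts on the centre through its `χ`-label.  Hence, for EVERY rank `N ≥ 3`: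

* §1 the CM rows, ANY hermitian non-degenerate `J_N`: `areIsomorphicRep_of_chi_eq_of_lineCarriers_of_isCMField` (equal `χ` ⟹ isomorphic
  `ω`'s), `mu_eq_and_sameClass_of_chi_eq_of_lineCarriers_of_isCMField`, `forall_mu_eq_of_chi_eq_of_lineCarriers_of_isCMField` (under
  [Lem. D.1 (3)] AS PRINTED read on the collection: equal `χ` ⟹ equal `μ` ∧ same `ε`-class — vacuous-by-collapse, in contrast with the
  two-member line-carrier certificates of the lineage at every other finite place);
* §2 ANY quadratic `E/F`, diagonal `J` of rank `N ≥ 3`: `forall_mu_eq_of_chi_eq_of_lineCarriers_of_diagonal`.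

NOT given: carriers of dimension `> 1`; the rows' OWN carriers `𝓢.omegaLoc v`; Lem. D.1 itself.  HC_CM is NOT proved.

Cell pub-hodgecm2 (COR-CM), audit class of the END rows `hD1''` ∕ `hD3`; seat prover-pub-hodgecm2-b10.

References: [Liu2021] Y. Liu, *Fourier–Jacobi cycles and arithmetic relative trace formula*, Camb. J. Math. 9 (2021) = arXiv:2102.11518,
App. D Lemma D.1 (1), (3) (l. 5229, 5233); [Dieudonne1971GroupesClassiques] J. Dieudonné, *La géométrie des groupes classiques*, 3e éd. (1971),
Chap. II §5.
-/

noncomputable section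

open scoped Matrix MatrixGroups
open NumberField IsDedekindDomain
open Literature.RepresentationTheory
open Literature.RepresentationTheory.Liu2021 (OscillatorStandingData)
open Literature.NumberTheory.GaloisRepresentations (HeckeCharacter)

namespace Literature.NumberTheory.Automorphic.Liu2021.LemD1IndexedNonVacuityCharacterDecisionAllRanks

open UnitaryGroup
open LemD1IndexedNonVacuityCharacterDecision (apply_scalar_eq_chi_of_item1_of_lineCarrier areIsomorphicRep_of_lineCarriers_of_eq)

/-! ## §1 The CM rows, rank `N ≥ 3`, ANY hermitian `J_N`: at the places of the conjunction LINE-carrier collections collapse -/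

section CM

open Literature.NumberTheory.GelbartRogawski1991.UnitaryDualPair (imagUnit complexConj_imagUnit imagUnit_ne_zero)

variable (L : Type) [Field L] [NumberField L] [IsCMField L]

local notation3 "cc" => (IsCMField.complexConj L)
local notation3 "L⁺" => (↥(maximalRealSubfield L))

variable (v : HeightOneSpectrum (𝓞 (maximalRealSubfield L))) {N : ℕ} (hN : 2 ≤ N) (hN3 : 3 ≤ N)
  (J : Matrix (Fin N) (Fin N) L) (hJh : (J.map (IsCMField.complexConj L))ᵀ = J) (hJdet : J.det ≠ 0)

include hN3 in
/-- **At a place of the conjunction two LINE-carrier members with the same `χ`-label have ISOMORPHIC `ω(μ, ε, χ)`'s** (CM rows, rank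
`N ≥ 3`, ANY hermitian `J_N`; item (1) for the collection): both carriers act on the centre through `χ_i = χ_j`, so the two characters of
`U(V)(L⁺_v)` coincide (✔ `…CharacterDecisionAllRanks.eq_of_forall_scalar_eq_of_isCMField`) and the lines are isomorphic.
[cite: Dieudonne1971GroupesClassiques, Chap. II §5] [cite: Liu2021, App. D Lemma D.1 (1) and (3) (l. 5229, 5233)] -/
theorem areIsomorphicRep_of_chi_eq_of_lineCarriers_of_isCMField (w : PlacesOver L v)
    (hconj : cc • w.1 = w.1 ∧ Odd N ∧ Valued.v ((N : w.1.adicCompletion L)) = 1 ∧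
      (v.asIdeal.ramificationIdx' w.1.asIdeal ≠ 1 ∨ Nat.Coprime N (Nat.card (𝓞 L⁺ ⧸ v.asIdeal) + 1)))
    {ι : Type} (Lf : LemD1IndexedFamily (v.adicCompletion L⁺) (LocalRing L v) N ι)
    (hS : Lf.S = LemD1OfPlace.standingData L v cc N J (complexConj_imagUnit L) (imagUnit_ne_zero L) hN hJh hJdet)
    (h1 : Lf.Item1AsPrinted) {i j : ι}
    (lamᵢ : Lf.S.U →* ℂˣ) (eᵢ : Lf.V i ≃ₗ[ℂ] ℂ) (hi : ∀ (g : Lf.S.U) (x : Lf.V i), eᵢ (Lf.omega i g x) = (lamᵢ g : ℂ) * eᵢ x)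
    (lamⱼ : Lf.S.U →* ℂˣ) (eⱼ : Lf.V j ≃ₗ[ℂ] ℂ) (hj : ∀ (g : Lf.S.U) (x : Lf.V j), eⱼ (Lf.omega j g x) = (lamⱼ g : ℂ) * eⱼ x)
    (hχ : Lf.chi j = Lf.chi i) : AreIsomorphicRep (Lf.quot j) (Lf.quot i) := by
  have hci := apply_scalar_eq_chi_of_item1_of_lineCarrier Lf hN3 h1 i lamᵢ eᵢ hi
  have hcj := apply_scalar_eq_chi_of_item1_of_lineCarrier Lf hN3 h1 j lamⱼ eⱼ hj
  have hχ' : (Lf.chi j).1 = (Lf.chi i).1 := congrArg Subtype.val hχ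
  -- the two characters agree on the centre, hence are equal at a place of the conjunction
  have hlam : lamᵢ = lamⱼ := by
    cases Lf
    dsimp only at hS
    subst hS
    exact eq_of_forall_scalar_eq_of_isCMField L v hN hN3 J hJh hJdet w hconj lamᵢ lamⱼ fun z => by rw [hci z, hcj z, hχ']
  subst hlam
  exact areIsomorphicRep_of_lineCarriers_of_eq Lf hN3 h1 lamᵢ eᵢ hi eⱼ hj

include hN3 in
/-- **… so under [Lem. D.1 (3)] AS PRINTED they have the same `μ` and the same `ε`-class**: at the places of the conjunction the records
read on LINE-carrier collections FORCE «same `χ` ⟹ same `μ` ∧ same `ε`-class», for every rank `N ≥ 3`.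
[cite: Liu2021, App. D Lemma D.1 (1) and (3) (l. 5229, 5233)] [cite: Dieudonne1971GroupesClassiques, Chap. II §5] -/
theorem mu_eq_and_sameClass_of_chi_eq_of_lineCarriers_of_isCMField (w : PlacesOver L v)
    (hconj : cc • w.1 = w.1 ∧ Odd N ∧ Valued.v ((N : w.1.adicCompletion L)) = 1 ∧
      (v.asIdeal.ramificationIdx' w.1.asIdeal ≠ 1 ∨ Nat.Coprime N (Nat.card (𝓞 L⁺ ⧸ v.asIdeal) + 1)))
    {ι : Type} (Lf : LemD1IndexedFamily (v.adicCompletion L⁺) (LocalRing L v) N ι)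
    (hS : Lf.S = LemD1OfPlace.standingData L v cc N J (complexConj_imagUnit L) (imagUnit_ne_zero L) hN hJh hJdet)
    (h1 : Lf.Item1AsPrinted) (h3 : LemD1_3AsPrintedI Lf) {i j : ι}
    (lamᵢ : Lf.S.U →* ℂˣ) (eᵢ : Lf.V i ≃ₗ[ℂ] ℂ) (hi : ∀ (g : Lf.S.U) (x : Lf.V i), eᵢ (Lf.omega i g x) = (lamᵢ g : ℂ) * eᵢ x)
    (lamⱼ : Lf.S.U →* ℂˣ) (eⱼ : Lf.V j ≃ₗ[ℂ] ℂ) (hj : ∀ (g : Lf.S.U) (x : Lf.V j), eⱼ (Lf.omega j g x) = (lamⱼ g : ℂ) * eⱼ x)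
    (hχ : Lf.chi j = Lf.chi i) : Lf.mu j = Lf.mu i ∧ LemD1.SameClass (Lf.eps i) (Lf.eps j) := by
  have hiso := areIsomorphicRep_of_chi_eq_of_lineCarriers_of_isCMField L v hN hN3 J hJh hJdet w hconj Lf hS h1 lamᵢ eᵢ hi
    lamⱼ eⱼ hj hχ
  exact ⟨h3.mu_eq_of_areIsomorphicRep hN3 hiso, (h3.sameClass_and_chi_eq_of_areIsomorphicRep hN3 hiso).1⟩

include hN3 in
/-- **Headline form**: at a place of the conjunction, for EVERY indexed collection over the rows' rank-`N` place model (`N ≥ 3`) all of whose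
carriers are LINES and which satisfies [Lem. D.1, first sentence + (1)] and [Lem. D.1 (3)] AS PRINTED, members with equal `χ`-labels have equal
`μ`-labels and `ε`-representatives in the same class. [cite: Liu2021, App. D Lemma D.1 (1) and (3) (l. 5229, 5233)]
[cite: Dieudonne1971GroupesClassiques, Chap. II §5] -/
theorem forall_mu_eq_of_chi_eq_of_lineCarriers_of_isCMField (w : PlacesOver L v)
    (hconj : cc • w.1 = w.1 ∧ Odd N ∧ Valued.v ((N : w.1.adicCompletion L)) = 1 ∧
      (v.asIdeal.ramificationIdx' w.1.asIdeal ≠ 1 ∨ Nat.Coprime N (Nat.card (𝓞 L⁺ ⧸ v.asIdeal) + 1)))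
    {ι : Type} (Lf : LemD1IndexedFamily (v.adicCompletion L⁺) (LocalRing L v) N ι)
    (hS : Lf.S = LemD1OfPlace.standingData L v cc N J (complexConj_imagUnit L) (imagUnit_ne_zero L) hN hJh hJdet)
    (h1 : Lf.Item1AsPrinted) (h3 : LemD1_3AsPrintedI Lf)
    (hline : ∀ k : ι, ∃ (lam : Lf.S.U →* ℂˣ) (e : Lf.V k ≃ₗ[ℂ] ℂ), ∀ (g : Lf.S.U) (x : Lf.V k), e (Lf.omega k g x) = (lam g : ℂ) * e x) :
    ∀ i j : ι, Lf.chi j = Lf.chi i → Lf.mu j = Lf.mu i ∧ LemD1.SameClass (Lf.eps i) (Lf.eps j) := fun i j hχ => by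
  obtain ⟨lamᵢ, eᵢ, hi⟩ := hline i
  obtain ⟨lamⱼ, eⱼ, hj⟩ := hline j
  exact mu_eq_and_sameClass_of_chi_eq_of_lineCarriers_of_isCMField L v hN hN3 J hJh hJdet w hconj Lf hS h1 h3 lamᵢ eᵢ hi lamⱼ eⱼ
    hj hχ

end CM

/-! ## §2 ANY quadratic `E/F`, diagonal `J` of rank `N ≥ 3`: the same collapse -/

section Diagonal

variable {F : Type} (E : Type) [Field F] [NumberField F] [Field E] [NumberField E] [Algebra F E]
  [Algebra.IsQuadraticExtension F E] (v : HeightOneSpectrum (𝓞 F)) (c : E ≃ₐ[F] E)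
  {δ : E} (hcδ : c δ = -δ) (hδ : δ ≠ 0) {N : ℕ} (hN : 2 ≤ N) (hN3 : 3 ≤ N)
  (d : Fin N → E) (hJh : ((Matrix.diagonal d).map c)ᵀ = Matrix.diagonal d) (hJdet : (Matrix.diagonal d).det ≠ 0)

include hcδ hJh hJdet hN3 in
/-- **Diagonal `J` of rank `N ≥ 3`, any `E/F`**: at a place of the conjunction, LINE-carrier collections over the rank-`N` place model satisfying
(1) and (3) AS PRINTED collapse — equal `χ` forces equal `μ` and the same `ε`-class (✔ `…CharacterDecisionAllRanks.eq_of_forall_scalar_eq_of_diagonal`).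
[cite: Liu2021, App. D Lemma D.1 (1) and (3) (l. 5229, 5233)] [cite: Dieudonne1971GroupesClassiques, Chap. II §5] -/
theorem forall_mu_eq_of_chi_eq_of_lineCarriers_of_diagonal (w : PlacesOver E v)
    (hconj : c • w.1 = w.1 ∧ Odd N ∧ Valued.v ((N : w.1.adicCompletion E)) = 1 ∧
      (v.asIdeal.ramificationIdx' w.1.asIdeal ≠ 1 ∨ Nat.Coprime N (Nat.card (𝓞 F ⧸ v.asIdeal) + 1)))
    {ι : Type} (Lf : LemD1IndexedFamily (v.adicCompletion F) (LocalRing E v) N ι)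
    (hS : Lf.S = LemD1OfPlace.standingData E v c N (Matrix.diagonal d) hcδ hδ hN hJh hJdet)
    (h1 : Lf.Item1AsPrinted) (h3 : LemD1_3AsPrintedI Lf)
    (hline : ∀ k : ι, ∃ (lam : Lf.S.U →* ℂˣ) (e : Lf.V k ≃ₗ[ℂ] ℂ), ∀ (g : Lf.S.U) (x : Lf.V k), e (Lf.omega k g x) = (lam g : ℂ) * e x) :
    ∀ i j : ι, Lf.chi j = Lf.chi i → Lf.mu j = Lf.mu i ∧ LemD1.SameClass (Lf.eps i) (Lf.eps j) := fun i j hχ => by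
  obtain ⟨lamᵢ, eᵢ, hi⟩ := hline i
  obtain ⟨lamⱼ, eⱼ, hj⟩ := hline j
  have hci := apply_scalar_eq_chi_of_item1_of_lineCarrier Lf hN3 h1 i lamᵢ eᵢ hi
  have hcj := apply_scalar_eq_chi_of_item1_of_lineCarrier Lf hN3 h1 j lamⱼ eⱼ hj
  have hχ' : (Lf.chi j).1 = (Lf.chi i).1 := congrArg Subtype.val hχ
  have hlam : lamᵢ = lamⱼ := by
    cases Lf
    dsimp only at hS
    subst hS
    exact eq_of_forall_scalar_eq_of_diagonal E v c hcδ hδ hN hN3 d hJh hJdet w hconj lamᵢ lamⱼ fun z => by rw [hci z, hcj z, hχ']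
  subst hlam
  have hiso := areIsomorphicRep_of_lineCarriers_of_eq Lf hN3 h1 lamᵢ eᵢ hi eⱼ hj
  exact ⟨h3.mu_eq_of_areIsomorphicRep hN3 hiso, (h3.sameClass_and_chi_eq_of_areIsomorphicRep hN3 hiso).1⟩

end Diagonal

end Literature.NumberTheory.Automorphic.Liu2021.LemD1IndexedNonVacuityCharacterDecisionAllRanks
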